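import Summits.QuantumAdvantage.QuantumAdvantage.Theorems.CubicForrelationNearExactIsExactCubicFormCells
import Summits.QuantumAdvantage.QuantumAdvantage.Theorems.CubicForrelationNearExactIsExactCubicFormR2PartnerTools
import Summits.QuantumAdvantage.QuantumAdvantage.Theorems.CubicForrelationNearExactIsExactKtThreeStructure

/-!
# Crux `CubicForrelation.NearExactIsExact` (stmt-QuantumAdvantage-14043) — E1280-even, R2 branch: the CELLS of the adapted frame and the
  DISPATCH on the lightest cell (zero / hyperplane / exceptional)

Certificate seat `b2b-cforr-cert` (gen 42).  HONEST FRAMING: kernel-checked bookkeeping (standard axioms) — the second step of `HR2`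
(…TwelvePartnerLight) after `tpw_R2_partner_frame` (…CubicFormR2Partner): in the adapted frame on `3 + 9` bits with the frame identity
`κ(y) ⊕ κ(y ⊕ e₀) = y₁ y₂`, the three free cells `ρ_{ij} = κ(0,i,j,·)` (`(i,j) ≠ (1,1)`) weigh `w₀₀ + w₀₁ + w₁₀ = (wt κ − 512)/2`
(`tcc_weight`), all cells are cubic and share the cubic form `t̄ = d|_S` (`tcc_third_rho_unit`); a LIGHTEST free cell has `w < 128`, and either
`w = 0` — then `t̄ = 0` and `tpw_R2_branch_zero` ends the proof — or Kasami–Tokura (`kt3_structure`, `m = 9`) puts its support in an affine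
hyperplane (`z, b`) or gives `32 w = 7·512` (the exceptional word).  The two surviving alternatives are handed to the hypotheses `HHYP`
(hyperplane type: R2-PARTNER §4 (T), (ω₄), (ω₆), (ω₈)) and `HEXC` (T⊕T′, §4(TT′)), whose exact statements this file fixes; they remain TO BE
PROVED (light frame `tlc_light_frame`/`tlc_coords`, block transport `tpw_partner_transport`, cell lemmas, leaves `tpa_R2_*`).  Nothing about
`θ₁₂`; NOT summit progress.

* `tpw_R2_cells`: cubic cells, shared cubic form (any base point), the weight identity.
* `tpw_R2_frame_false_of_branches`: `HHYP ∧ HEXC ⇒` the adapted-frame package with `wt κ < 1280` is contradictory.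

References: this seat lineage (g37 R2-PARTNER §2–4, g39 HANDPROOFS §1, g40–41 tools).  Axioms: the standard three.
-/

set_option linter.dupNamespace false -- D-0017: single-problem summit ⇒ `QuantumAdvantage.QuantumAdvantage` by design

namespace Summit.QuantumAdvantage.QuantumAdvantage.Theorems.CubicForrelation.NearExactIsExact

open Finset
open Literature.Computability.QuantumComplexity
open Literature.Computability.QuantumComplexity.BuzetChailloux (bxor zeroVec bxor_comm bxor_self bxor_zeroVec zeroVec_bxor
  bxor_bxor_cancel_left)

/-- **The cells of the adapted frame.**  For `κ` cubic on `3 + 9` bits with cubic form `d` and the frame identity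
`κ(y) ⊕ κ(y ⊕ e₀) = y₁ y₂`: every cell `ρ_v = κ(v, ·)` is cubic; the `S`-block of `d` is the cubic form of every cell at every base point
`x`; and `wt κ = 2⁹ + 2 (w₀₀ + w₀₁ + w₁₀)`. [this work] -/
theorem tpw_R2_cells (κ : (Fin (3 + 9) → Bool) → Bool) (hκ : IsDegLeFun 3 κ)
    (d : Fin (3 + 9) → Fin (3 + 9) → Fin (3 + 9) → ZMod 2)
    (hd : ∀ φ j k, d φ j k =
      if ((((κ zeroVec ^^ κ (bxor zeroVec (fun l => decide (l = k)))) ^^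
            (κ (bxor zeroVec (fun l => decide (l = j))) ^^ κ (bxor (bxor zeroVec (fun l => decide (l = j))) (fun l => decide (l = k))))) ^^
          ((κ (bxor zeroVec (fun l => decide (l = φ))) ^^ κ (bxor (bxor zeroVec (fun l => decide (l = φ))) (fun l => decide (l = k)))) ^^
            (κ (bxor (bxor zeroVec (fun l => decide (l = φ))) (fun l => decide (l = j))) ^^
              κ (bxor (bxor (bxor zeroVec (fun l => decide (l = φ))) (fun l => decide (l = j))) (fun l => decide (l = k))))))) = true
      then 1 else 0)
    (hD0 : ∀ y, (κ y ^^ κ (bxor y (fun l => decide (l = Fin.castAdd 9 (0 : Fin 3))))) =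
      (y (Fin.castAdd 9 (1 : Fin 3)) && y (Fin.castAdd 9 (2 : Fin 3)))) :
    (∀ v : Fin 3 → Bool, IsDegLeFun 3 (fun s : Fin 9 → Bool => κ (Fin.append v s))) ∧
    (∀ (v : Fin 3 → Bool) (σ τ υ : Fin 9) (x : Fin 9 → Bool), d (Fin.natAdd 3 σ) (Fin.natAdd 3 τ) (Fin.natAdd 3 υ) =
      if ((((κ (Fin.append v x) ^^ κ (Fin.append v (bxor x (fun l => decide (l = υ))))) ^^
              (κ (Fin.append v (bxor x (fun l => decide (l = τ)))) ^^ κ (Fin.append v (bxor (bxor x (fun l => decide (l = τ))) (fun l => decide (l = υ)))))) ^^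
            ((κ (Fin.append v (bxor x (fun l => decide (l = σ)))) ^^ κ (Fin.append v (bxor (bxor x (fun l => decide (l = σ))) (fun l => decide (l = υ))))) ^^
              (κ (Fin.append v (bxor (bxor x (fun l => decide (l = σ))) (fun l => decide (l = τ)))) ^^
                κ (Fin.append v (bxor (bxor (bxor x (fun l => decide (l = σ))) (fun l => decide (l = τ))) (fun l => decide (l = υ)))))))) = true
      then 1 else 0) ∧
    #(univ.filter fun y : Fin (3 + 9) → Bool => κ y = true) =
      2 ^ 9 + 2 * (#(univ.filter fun s : Fin 9 → Bool => κ (Fin.append ![false, false, false] s) = true) +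
        #(univ.filter fun s : Fin 9 → Bool => κ (Fin.append ![false, false, true] s) = true) +
        #(univ.filter fun s : Fin 9 → Bool => κ (Fin.append ![false, true, false] s) = true)) := by
  refine ⟨fun v => tcc_rho_isDegLeFun κ v hκ, fun v σ τ υ x => ?_, ?_⟩
  · have h := tcc_third_rho_unit κ v hκ σ τ υ x zeroVec
    dsimp only at h
    rw [hd, ← h]
  · have hD0' : ∀ y, (κ y ^^ κ (bxor y (fun l => decide (l = Fin.castAdd 9 (0 : Fin 3))))) =
        ((y (Fin.castAdd 9 (1 : Fin 3)) ^^ false) && (y (Fin.castAdd 9 (2 : Fin 3)) ^^ false)) := fun y => by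
      rw [hD0 y, Bool.xor_false, Bool.xor_false]
    simpa only [Bool.not_false] using tcc_weight κ false false hD0'

/-- **R2 in the adapted frame, from the two light-cell branches.**  GIVEN the branch statements
`HHYP` (the lightest free cell is non-zero and supported in an affine hyperplane `⟨s,z⟩ = b` — the K–T hyperplane type: descendants `T`,
`s₀ω₄`, `s₀ω₆`, `s₀ω₈`) and `HEXC` (the lightest free cell has `32 w = 7·2⁹`, the exceptional word — descendant `T⊕T′`), both stated for
the full adapted-frame package (cubic `κ`, symmetric partner `c`, cubic form `d`, `(PAIR)`, frame identity, `hF1`, `w₀₀+w₀₁+w₁₀ < 384`, the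
light cell `(i,j)` with its minimality and positivity): every adapted-frame package with `wt κ < 1280` is contradictory.
Proof: `tpw_R2_cells`; a lightest free cell has `3w ≤ w₀₀+w₀₁+w₁₀ < 384`; `w = 0` ⇒ the cell vanishes ⇒ `t̄ = 0` ⇒ `tpw_R2_branch_zero`;
else `kt3_structure` (`4w < 2⁹`).  NOT summit progress: `HHYP`, `HEXC` are not yet kernel theorems. [this work] -/
theorem tpw_R2_frame_false_of_branches
    (HHYP :
      ∀ (κ : (Fin (3 + 9) → Bool) → Bool), IsDegLeFun 3 κ →
      ∀ (c d : Fin (3 + 9) → Fin (3 + 9) → Fin (3 + 9) → ZMod 2),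
      (∀ p j k, c p k j = c p j k) → (∀ p j k, c j p k = c p j k) → (∀ p j, c p j j = 0) →
      (∀ φ j k, d φ k j = d φ j k) → (∀ φ j k, d j φ k = d φ j k) → (∀ φ j, d φ j j = 0) →
      (∀ φ j k, d φ j k =
        if ((((κ zeroVec ^^ κ (bxor zeroVec (fun l => decide (l = k)))) ^^
                (κ (bxor zeroVec (fun l => decide (l = j))) ^^ κ (bxor (bxor zeroVec (fun l => decide (l = j))) (fun l => decide (l = k))))) ^^
              ((κ (bxor zeroVec (fun l => decide (l = φ))) ^^ κ (bxor (bxor zeroVec (fun l => decide (l = φ))) (fun l => decide (l = k)))) ^^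
                (κ (bxor (bxor zeroVec (fun l => decide (l = φ))) (fun l => decide (l = j))) ^^
                  κ (bxor (bxor (bxor zeroVec (fun l => decide (l = φ))) (fun l => decide (l = j))) (fun l => decide (l = k))))))) = true
        then 1 else 0) →
      (∀ p φ, (∑ j, ∑ k, (if j < k then c p j k * d φ j k else 0)) = if p = φ then 1 else 0) →
      (∀ y, (κ y ^^ κ (bxor y (fun l => decide (l = Fin.castAdd 9 (0 : Fin 3))))) =
        (y (Fin.castAdd 9 (1 : Fin 3)) && y (Fin.castAdd 9 (2 : Fin 3)))) →
      (∀ j k, d (Fin.castAdd 9 0) j k =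
        if (j = Fin.castAdd 9 1 ∧ k = Fin.castAdd 9 2) ∨ (j = Fin.castAdd 9 2 ∧ k = Fin.castAdd 9 1) then 1 else 0) →
      #(univ.filter fun s : Fin 9 → Bool => κ (Fin.append ![false, false, false] s) = true) +
        #(univ.filter fun s : Fin 9 → Bool => κ (Fin.append ![false, false, true] s) = true) +
        #(univ.filter fun s : Fin 9 → Bool => κ (Fin.append ![false, true, false] s) = true) < 384 →
      ∀ (i j : Bool), (i && j) = false →
      (∀ i' j' : Bool, (i' && j') = false →
        #(univ.filter fun s : Fin 9 → Bool => κ (Fin.append ![false, i, j] s) = true) ≤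
          #(univ.filter fun s : Fin 9 → Bool => κ (Fin.append ![false, i', j'] s) = true)) →
      0 < #(univ.filter fun s : Fin 9 → Bool => κ (Fin.append ![false, i, j] s) = true) →
      ∀ (z : Fin 9 → Bool) (b : Bool), z ≠ zeroVec →
      (∀ s, κ (Fin.append ![false, i, j] s) = true → decide (Odd #(univ.filter fun l => (s l && z l) = true)) = b) → False)
    (HEXC :
      ∀ (κ : (Fin (3 + 9) → Bool) → Bool), IsDegLeFun 3 κ →
      ∀ (c d : Fin (3 + 9) → Fin (3 + 9) → Fin (3 + 9) → ZMod 2),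
      (∀ p j k, c p k j = c p j k) → (∀ p j k, c j p k = c p j k) → (∀ p j, c p j j = 0) →
      (∀ φ j k, d φ k j = d φ j k) → (∀ φ j k, d j φ k = d φ j k) → (∀ φ j, d φ j j = 0) →
      (∀ φ j k, d φ j k =
        if ((((κ zeroVec ^^ κ (bxor zeroVec (fun l => decide (l = k)))) ^^
                (κ (bxor zeroVec (fun l => decide (l = j))) ^^ κ (bxor (bxor zeroVec (fun l => decide (l = j))) (fun l => decide (l = k))))) ^^
              ((κ (bxor zeroVec (fun l => decide (l = φ))) ^^ κ (bxor (bxor zeroVec (fun l => decide (l = φ))) (fun l => decide (l = k)))) ^^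
                (κ (bxor (bxor zeroVec (fun l => decide (l = φ))) (fun l => decide (l = j))) ^^
                  κ (bxor (bxor (bxor zeroVec (fun l => decide (l = φ))) (fun l => decide (l = j))) (fun l => decide (l = k))))))) = true
        then 1 else 0) →
      (∀ p φ, (∑ j, ∑ k, (if j < k then c p j k * d φ j k else 0)) = if p = φ then 1 else 0) →
      (∀ y, (κ y ^^ κ (bxor y (fun l => decide (l = Fin.castAdd 9 (0 : Fin 3))))) =
        (y (Fin.castAdd 9 (1 : Fin 3)) && y (Fin.castAdd 9 (2 : Fin 3)))) →
      (∀ j k, d (Fin.castAdd 9 0) j k =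
        if (j = Fin.castAdd 9 1 ∧ k = Fin.castAdd 9 2) ∨ (j = Fin.castAdd 9 2 ∧ k = Fin.castAdd 9 1) then 1 else 0) →
      #(univ.filter fun s : Fin 9 → Bool => κ (Fin.append ![false, false, false] s) = true) +
        #(univ.filter fun s : Fin 9 → Bool => κ (Fin.append ![false, false, true] s) = true) +
        #(univ.filter fun s : Fin 9 → Bool => κ (Fin.append ![false, true, false] s) = true) < 384 →
      ∀ (i j : Bool), (i && j) = false →
      (∀ i' j' : Bool, (i' && j') = false →
        #(univ.filter fun s : Fin 9 → Bool => κ (Fin.append ![false, i, j] s) = true) ≤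
          #(univ.filter fun s : Fin 9 → Bool => κ (Fin.append ![false, i', j'] s) = true)) →
      0 < #(univ.filter fun s : Fin 9 → Bool => κ (Fin.append ![false, i, j] s) = true) →
      32 * #(univ.filter fun s : Fin 9 → Bool => κ (Fin.append ![false, i, j] s) = true) = 7 * 2 ^ 9 →
      (¬ ∃ (z : Fin 9 → Bool) (b : Bool), z ≠ zeroVec ∧
        ∀ s, κ (Fin.append ![false, i, j] s) = true → decide (Odd #(univ.filter fun l => (s l && z l) = true)) = b) → False)
    (κ : (Fin (3 + 9) → Bool) → Bool) (hκ : IsDegLeFun 3 κ)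
    (c d : Fin (3 + 9) → Fin (3 + 9) → Fin (3 + 9) → ZMod 2)
    (hcs : ∀ p j k, c p k j = c p j k) (hcc : ∀ p j k, c j p k = c p j k) (hcd : ∀ p j, c p j j = 0)
    (hds : ∀ φ j k, d φ k j = d φ j k) (hdc : ∀ φ j k, d j φ k = d φ j k) (hdd : ∀ φ j, d φ j j = 0)
    (hd : ∀ φ j k, d φ j k =
      if ((((κ zeroVec ^^ κ (bxor zeroVec (fun l => decide (l = k)))) ^^
            (κ (bxor zeroVec (fun l => decide (l = j))) ^^ κ (bxor (bxor zeroVec (fun l => decide (l = j))) (fun l => decide (l = k))))) ^^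
          ((κ (bxor zeroVec (fun l => decide (l = φ))) ^^ κ (bxor (bxor zeroVec (fun l => decide (l = φ))) (fun l => decide (l = k)))) ^^
            (κ (bxor (bxor zeroVec (fun l => decide (l = φ))) (fun l => decide (l = j))) ^^
              κ (bxor (bxor (bxor zeroVec (fun l => decide (l = φ))) (fun l => decide (l = j))) (fun l => decide (l = k))))))) = true
      then 1 else 0)
    (hpair : ∀ p φ, (∑ j, ∑ k, (if j < k then c p j k * d φ j k else 0)) = if p = φ then 1 else 0)
    (hD0 : ∀ y, (κ y ^^ κ (bxor y (fun l => decide (l = Fin.castAdd 9 (0 : Fin 3))))) =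
      (y (Fin.castAdd 9 (1 : Fin 3)) && y (Fin.castAdd 9 (2 : Fin 3))))
    (hF1 : ∀ j k, d (Fin.castAdd 9 0) j k =
      if (j = Fin.castAdd 9 1 ∧ k = Fin.castAdd 9 2) ∨ (j = Fin.castAdd 9 2 ∧ k = Fin.castAdd 9 1) then 1 else 0)
    (hlt : #(univ.filter fun y : Fin (3 + 9) → Bool => κ y = true) < 1280) : False := by
  obtain ⟨hcub, htb, hwt⟩ := tpw_R2_cells κ hκ d hd hD0
  -- the three free cells' weights
  obtain ⟨w, hw⟩ : ∃ w : Bool → Bool → ℕ, ∀ i j, w i j = #(univ.filter fun s : Fin 9 → Bool => κ (Fin.append ![false, i, j] s) = true) :=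
    ⟨_, fun _ _ => rfl⟩
  have hsum : #(univ.filter fun s : Fin 9 → Bool => κ (Fin.append ![false, false, false] s) = true) +
      #(univ.filter fun s : Fin 9 → Bool => κ (Fin.append ![false, false, true] s) = true) +
      #(univ.filter fun s : Fin 9 → Bool => κ (Fin.append ![false, true, false] s) = true) < 384 := by
    rw [hwt] at hlt
    norm_num at hlt
    omega
  have hsum' : w false false + w false true + w true false < 384 := by rw [hw, hw, hw]; exact hsum
  -- a lightest free cell
  obtain ⟨i, j, hij, hmin⟩ : ∃ i j : Bool, (i && j) = false ∧ ∀ i' j' : Bool, (i' && j') = false → w i j ≤ w i' j' := by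
    by_cases h1 : w false false ≤ w false true ∧ w false false ≤ w true false
    · refine ⟨false, false, rfl, fun i' j' h => ?_⟩
      cases i' <;> cases j'
      · exact le_rfl
      · exact h1.1
      · exact h1.2
      · exact absurd h (by decide)
    · by_cases h2 : w false true ≤ w true false
      · refine ⟨false, true, rfl, fun i' j' h => ?_⟩
        cases i' <;> cases j'
        · omega
        · exact le_rfl
        · exact h2
        · exact absurd h (by decide)
      · refine ⟨true, false, rfl, fun i' j' h => ?_⟩
        cases i' <;> cases j'
        · omega
        · omega
        · exact le_rfl
        · exact absurd h (by decide)
  have hmin' : ∀ i' j' : Bool, (i' && j') = false →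
      #(univ.filter fun s : Fin 9 → Bool => κ (Fin.append ![false, i, j] s) = true) ≤
        #(univ.filter fun s : Fin 9 → Bool => κ (Fin.append ![false, i', j'] s) = true) := fun i' j' h => by
    rw [← hw, ← hw]; exact hmin i' j' h
  have h128 : w i j < 128 := by
    have h1 := hmin false false rfl
    have h2 := hmin false true rfl
    have h3 := hmin true false rfl
    omega
  by_cases hzero : w i j = 0
  · -- the lightest cell vanishes identically: descendant `t̄ = 0`
    rw [hw, card_eq_zero] at hzero
    have hρ0 : ∀ s, κ (Fin.append ![false, i, j] s) = false := fun s => by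
      have hs := filter_eq_empty_iff.1 hzero (mem_univ s)
      revert hs
      cases κ (Fin.append ![false, i, j] s) <;> decide
    refine tpw_R2_branch_zero c d hcs hcc hds hdc hdd hpair hF1 fun σ τ υ => ?_
    rw [htb ![false, i, j] σ τ υ zeroVec]
    simp only [hρ0, Bool.xor_self]
    exact if_neg Bool.false_ne_true
  · have hpos : 0 < #(univ.filter fun s : Fin 9 → Bool => κ (Fin.append ![false, i, j] s) = true) := by
      rw [← hw]; omega
    have h4 : 4 * #(univ.filter fun s : Fin 9 → Bool => κ (Fin.append ![false, i, j] s) = true) < 2 ^ 9 := by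
      rw [← hw]; norm_num; omega
    by_cases hgen : ∃ (z : Fin 9 → Bool) (b : Bool), z ≠ zeroVec ∧
        ∀ s, κ (Fin.append ![false, i, j] s) = true → decide (Odd #(univ.filter fun l => (s l && z l) = true)) = b
    · obtain ⟨z, b, hz, hsupp⟩ := hgen
      exact HHYP κ hκ c d hcs hcc hcd hds hdc hdd hd hpair hD0 hF1 hsum i j hij hmin' hpos z b hz hsupp
    · rcases kt3_structure (fun s : Fin 9 → Bool => κ (Fin.append ![false, i, j] s)) (hcub ![false, i, j]) hpos h4 with
        ⟨z, b, hz, hsupp⟩ | hexc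
      · exact absurd ⟨z, b, hz, hsupp⟩ hgen
      · exact HEXC κ hκ c d hcs hcc hcd hds hdc hdd hd hpair hD0 hF1 hsum i j hij hmin' hpos hexc hgen

end Summit.QuantumAdvantage.QuantumAdvantage.Theorems.CubicForrelation.NearExactIsExact
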